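import Summits.Schanuel.Schanuel.Theorems.RootDecomp1KHyper56

/-!
# RootDecomp1KHyper — lens 6, generation 17 «BILOG STAIRCASE CELL» (BilogStair.lean edition 2 f0528a77…, 2567 l) — continuation (RootDecomp1KHyper57): §E structural certificates of the member (span on the imaginary axis, `not_pi_mem_span_zB`, `HasAlgLatAnchor`-type bookkeeping, `cexp_lattice_eq`, `lattice_ne_zero`)

(lens-6 g17 `BilogStair.lean` edition 2, sha256 f0528a77…5850, own farm rc 0 · 0 sorry · axioms std; critic ACK STATUS L1737 PORT GO LOW (registered, no credit);
port by census-1 gen 15 in ten parts `RootDecomp1KHyper53`–`62` — see the PORT NOTE of part 53; `--supports stmt-Schanuel-33363`; rung 0.)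
-/

open Complex Polynomial IntermediateField Filter
open scoped BigOperators

namespace Summit.Schanuel.Schanuel.Theorems.RootDecomp1KHyper

namespace HyperCell

namespace LatCell

namespace Bilog

/-! ## §E  Structural certificates of the member (the span of `z_B` lies on the imaginary axis)

`span_ℤ(z_B) = i·(ℤπ + ℤℓ₀ + ℤy_B) ⊂ iℝ`.  Hence, HYPOTHESIS-FREE: `¬HasPiIntAnchor`, `¬HasPiLatAnchor`,
`¬HasExpIntAnchor`, `¬HasExpPairAnchor` (the last because `e^{α} ∈ iℝ` is impossible for algebraic `α`:
`cos (Im α) = 0` would make `π` algebraic), so `¬HasExpLatAnchor`; and `¬HasAlgLatAnchor` (g16's cell) by the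
tree-PROVED Hermite–Lindemann theorem (`Literature…transcendental_exp_holds`): an algebraic `i t ∈ span` with
`t = Uπ + Vℓ₀` forces `e^{it} = (−1)^U α₀^V` algebraic.  NOT certified here (see NODE-g17.md): `¬HasHLPairInSpan z_B`
(needs a polynomial lower bound for the linear form `Uπ + Vℓ₀` in two logarithms — Baker–Wüstholz — the elementary
bound `5^{−|V|}` leaves a two-scale gap) and `¬HasMeasuredRatAnchor z_B` (UNDECIDABLE by design: `θ = (iπ, iℓ₀)` is a
rational anchor pair of the span, and whether it is weakly measured is the open quantitative independence of
`π` and `log α₀`; the cell theorem above is exactly what decides `SB 3 z_B` WITHOUT that measure). -/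

/-- `π` is transcendental (as a complex number). -/
private theorem transcendental_pi_C : Transcendental ℚ (Real.pi : ℂ) := fun h =>
  Literature.NumberTheory.Transcendental.transcendental_pi_holds
    ((isAlgebraic_algebraMap_iff (A := ℂ) Complex.ofReal_injective).mp h)

/-- Elements of the `ℤ`-span of `z_B` are `i·(Uπ + Vℓ₀ + W y_B)`. -/
theorem mem_span_zB {v : ℂ} (hv : v ∈ Submodule.span ℤ (Set.range zB)) :
    ∃ U V W : ℤ, v = (((U : ℝ) * Real.pi + (V : ℝ) * ell + (W : ℝ) * yB : ℝ) : ℂ) * I := by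
  obtain ⟨c, rfl⟩ := (Submodule.mem_span_range_iff_exists_fun ℤ).mp hv
  refine ⟨c 0, c 1, c 2, ?_⟩
  simp only [Fin.sum_univ_three, zB, Matrix.cons_val_zero, Matrix.cons_val_one, Matrix.cons_val_two,
    Matrix.head_cons, Matrix.tail_cons, zsmul_eq_mul]
  push_cast
  ring

/-- Every element of the `ℤ`-span of `z_B` is purely imaginary. -/
theorem re_eq_zero_of_mem_span_zB {v : ℂ} (hv : v ∈ Submodule.span ℤ (Set.range zB)) : v.re = 0 := by
  obtain ⟨U, V, W, rfl⟩ := mem_span_zB hv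
  simp

/-- No non-zero integer lies in the `ℤ`-span of `z_B`. -/
theorem not_intCast_mem_span_zB {N : ℤ} (hN : N ≠ 0) : (N : ℂ) ∉ Submodule.span ℤ (Set.range zB) := by
  intro h
  have := re_eq_zero_of_mem_span_zB h
  simp at this
  exact hN this

/-- `π` does not lie in the `ℤ`-span of `z_B`. -/
theorem not_pi_mem_span_zB : (Real.pi : ℂ) ∉ Submodule.span ℤ (Set.range zB) := by
  intro h
  have := re_eq_zero_of_mem_span_zB h
  simp [Real.pi_ne_zero] at this

/-- `¬HasPiIntAnchor z_B` (hypothesis-free). -/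
theorem not_hasPiIntAnchor_zB : ¬ HasPiIntAnchor zB := fun ⟨_, hN, hNmem, _⟩ =>
  not_intCast_mem_span_zB hN hNmem

/-- `¬HasPiLatAnchor z_B` (hypothesis-free). -/
theorem not_hasPiLatAnchor_zB : ¬ HasPiLatAnchor zB := fun ⟨hπ, _⟩ => not_pi_mem_span_zB hπ

/-- `¬HasExpIntAnchor z_B` (hypothesis-free). -/
theorem not_hasExpIntAnchor_zB : ¬ HasExpIntAnchor zB := fun ⟨_, _, _, _, _, hN₁, _, hmem, _⟩ =>
  not_intCast_mem_span_zB hN₁ hmem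

/-- `e^{α}` is never purely imaginary for algebraic `α` (else `π` would be algebraic). -/
theorem re_cexp_ne_zero_of_isAlgebraic {α : ℂ} (hα : IsAlgebraic ℚ α) : (cexp α).re ≠ 0 := by
  intro h
  rw [Complex.exp_re] at h
  have hcos : Real.cos α.im = 0 := by
    rcases mul_eq_zero.mp h with h1 | h1
    · exact absurd h1 (Real.exp_pos _).ne'
    · exact h1
  obtain ⟨k, hk⟩ := Real.cos_eq_zero_iff.mp hcos
  -- `Im α` is algebraic
  have hint : IsIntegral ℚ α := isAlgebraic_iff_isIntegral.mp hα
  have hconj : IsIntegral ℚ ((starRingEnd ℂ) α) := hint.map (Complex.conjAe.restrictScalars ℚ)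
  have hI : IsIntegral ℚ I := by
    refine IsIntegral.of_pow (n := 4) (by norm_num) ?_
    rw [show (4 : ℕ) = 2 * 2 from rfl, pow_mul, I_sq]; norm_num; exact isIntegral_one
  have him : IsIntegral ℚ ((α.im : ℝ) : ℂ) := by
    have e : ((α.im : ℝ) : ℂ) = (α - (starRingEnd ℂ) α) * (algebraMap ℚ ℂ (-1 / 2) * I) := by
      rw [Complex.sub_conj, map_div₀, map_neg, map_one, map_ofNat]
      push_cast
      linear_combination ((α.im : ℝ) : ℂ) * I_sq
    rw [e]
    exact (hint.sub hconj).mul (isIntegral_algebraMap.mul hI)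
  -- hence `π` is algebraic
  have hk0 : (2 * (k : ℝ) + 1) ≠ 0 := by
    intro h0
    have : (2 * k + 1 : ℤ) = 0 := by exact_mod_cast h0
    omega
  have hπ : (Real.pi : ℂ) = ((α.im : ℝ) : ℂ) * algebraMap ℚ ℂ (2 / (2 * k + 1)) := by
    rw [hk, map_div₀, map_add, map_mul, map_one, map_ofNat, map_intCast]
    push_cast
    have hk0' : (2 * (k : ℂ) + 1) ≠ 0 := by exact_mod_cast hk0
    field_simp
  exact transcendental_pi_C (isAlgebraic_iff_isIntegral.mpr (hπ ▸ him.mul isIntegral_algebraMap))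

/-- `¬HasExpPairAnchor z_B` (hypothesis-free). -/
theorem not_hasExpPairAnchor_zB : ¬ HasExpPairAnchor zB := by
  rintro ⟨α, N₁, N₂, halg, -, hN₁, -, h1, -⟩
  have hre := re_eq_zero_of_mem_span_zB h1
  simp only [Complex.mul_re, Complex.intCast_re, Complex.intCast_im, zero_mul, sub_zero] at hre
  rcases mul_eq_zero.mp hre with h | h
  · exact hN₁ (by exact_mod_cast h)
  · exact re_cexp_ne_zero_of_isAlgebraic (halg 0) h

/-- `¬HasExpLatAnchor z_B` (hypothesis-free). -/
theorem not_hasExpLatAnchor_zB : ¬ HasExpLatAnchor zB := fun h =>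
  h.elim not_hasExpIntAnchor_zB not_hasExpPairAnchor_zB

/-- g16's algebraic-lattice anchor (copied verbatim from lens 6 gen 16, `AlgLatAnchor.lean` l.919; HOME files are not
importable): two ℚ-linearly independent ALGEBRAIC numbers in the ℤ-span. -/
def HasAlgLatAnchor {N : ℕ} (z : Fin N → ℂ) : Prop :=
  ∃ w₁ w₂ : ℂ, IsAlgebraic ℚ w₁ ∧ IsAlgebraic ℚ w₂ ∧ LinearIndependent ℚ ![w₁, w₂] ∧
    w₁ ∈ Submodule.span ℤ (Set.range z) ∧ w₂ ∈ Submodule.span ℤ (Set.range z)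

/-- `e^{i(Uπ + Vℓ₀)} = (−1)^U α₀^V` is algebraic. -/
theorem isAlgebraic_cexp_lattice (U V : ℤ) :
    IsAlgebraic ℚ (cexp ((((U : ℝ) * Real.pi + (V : ℝ) * ell : ℝ) : ℂ) * I)) := by
  have e : (((U : ℝ) * Real.pi + (V : ℝ) * ell : ℝ) : ℂ) * I =
      (U : ℂ) * ((Real.pi : ℂ) * I) + (V : ℂ) * ((ell : ℂ) * I) := by push_cast; ring
  rw [e, Complex.exp_add, Complex.exp_int_mul, Complex.exp_int_mul, Complex.exp_pi_mul_I]
  refine IsAlgebraic.mul ?_ ?_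
  · rcases Int.even_or_odd U with hU | hU
    · rw [hU.neg_one_zpow]; exact isAlgebraic_one
    · rw [hU.neg_one_zpow]; exact isAlgebraic_one.neg
  · rcases le_or_gt 0 V with hV | hV
    · obtain ⟨n, rfl⟩ := Int.eq_ofNat_of_zero_le hV
      rw [zpow_natCast]; exact isAlgebraic_cexp_ell.pow _
    · obtain ⟨n, hn⟩ := Int.exists_eq_neg_ofNat hV.le
      rw [hn, zpow_neg, zpow_natCast]
      exact (isAlgebraic_cexp_ell.pow _).inv

/-- An algebraic element of the span of `z_B` not involving `y_B` is zero (Hermite–Lindemann). -/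
theorem lattice_algebraic_eq_zero {U V : ℤ}
    (halg : IsAlgebraic ℚ ((((U : ℝ) * Real.pi + (V : ℝ) * ell : ℝ) : ℂ) * I)) :
    (((U : ℝ) * Real.pi + (V : ℝ) * ell : ℝ) : ℂ) * I = 0 := by
  by_contra hne
  exact Literature.NumberTheory.Transcendental.transcendental_exp_holds halg hne (isAlgebraic_cexp_lattice U V)

/-- **`¬HasAlgLatAnchor z_B`** — by the tree-PROVED Hermite–Lindemann theorem. -/
theorem not_hasAlgLatAnchor_zB : ¬ HasAlgLatAnchor zB := by
  rintro ⟨w₁, w₂, h₁, h₂, hli, hw₁, hw₂⟩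
  obtain ⟨U, V, W, rfl⟩ := mem_span_zB hw₁
  obtain ⟨U', V', W', rfl⟩ := mem_span_zB hw₂
  have hli' := LinearIndependent.pair_iff.mp hli
  by_cases hW : W = 0
  · subst hW
    have h0 := lattice_algebraic_eq_zero (U := U) (V := V) (by simpa using h₁)
    have := hli' 1 0 (by simp only [one_smul, zero_smul, add_zero]; simpa using h0)
    simp at this
  · -- eliminate `y_B`: `W' w₁ − W w₂` is algebraic, in the lattice part, and non-zero
    have hcomb : (W' : ℚ) • ((((U : ℝ) * Real.pi + (V : ℝ) * ell + (W : ℝ) * yB : ℝ) : ℂ) * I) +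
        (-(W : ℚ)) • ((((U' : ℝ) * Real.pi + (V' : ℝ) * ell + (W' : ℝ) * yB : ℝ) : ℂ) * I) =
        ((((W' * U - W * U' : ℤ) : ℝ) * Real.pi + ((W' * V - W * V' : ℤ) : ℝ) * ell : ℝ) : ℂ) * I := by
      simp only [Rat.smul_def]
      push_cast
      ring
    have halg : IsAlgebraic ℚ (((((W' * U - W * U' : ℤ) : ℝ) * Real.pi +
        ((W' * V - W * V' : ℤ) : ℝ) * ell : ℝ) : ℂ) * I) := by
      rw [← hcomb, Rat.smul_def, Rat.smul_def]
      exact ((isAlgebraic_algebraMap _).mul h₁).add ((isAlgebraic_algebraMap _).mul h₂)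
    have h0 := lattice_algebraic_eq_zero halg
    rw [← hcomb] at h0
    have := hli' (W' : ℚ) (-(W : ℚ)) h0
    simp only [neg_eq_zero, Int.cast_eq_zero] at this
    exact hW this.2

/-- **Placement of `z_B`** (hypothesis-free part): hyper-lin-Liouville, no `π`-anchors, no exponential anchors, no
algebraic-lattice anchor. -/
theorem placement_zB :
    HyperLinLiouville zB ∧ ¬ HasPiIntAnchor zB ∧ ¬ HasPiLatAnchor zB ∧ ¬ HasExpLatAnchor zB ∧
      ¬ HasAlgLatAnchor zB :=
  ⟨hyperLinLiouville_zB, not_hasPiIntAnchor_zB, not_hasPiLatAnchor_zB, not_hasExpLatAnchor_zB,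
    not_hasAlgLatAnchor_zB⟩

/-! ### §E.2  `z_B` is `ℚ`-linearly independent — ELEMENTARY (Gaussian integers vs. the doubly-exponential error)

For `V ≠ 0`, `5^{|V|}(e^{i(Uπ+Vℓ₀)} − 1) = a + bi` is a Gaussian integer with `b = ±Im (3±4i)^{|V|} ≡ ±4 (mod 5)`,
so `|Uπ + Vℓ₀| ≥ |e^{i(Uπ+Vℓ₀)} − 1| ≥ 5^{−|V|}` (no Baker-type bound needed); a rational relation `y_B = sπ + tℓ₀`
would make `E_K·err_K = U_Kπ + V_Kℓ₀` with `|V_K| ≤ c·2^{a_K}` and `0 < err_K ≤ 10·2^{−a_{K+1}}`, contradicting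
`a_{K+1} = 2^{(K+1)a_K}`. -/

/-- `u_M ≡ 3`, `v_M ≡ 4 (mod 5)` for `M ≥ 1`. -/
theorem uv_mod_five (M : ℕ) (hM : 1 ≤ M) : (5 : ℤ) ∣ (uv M).1 - 3 ∧ (5 : ℤ) ∣ (uv M).2 - 4 := by
  induction M, hM using Nat.le_induction with
  | base => exact ⟨⟨0, by simp [uv]⟩, ⟨0, by simp [uv]⟩⟩
  | succ M hM ih =>
      obtain ⟨⟨p, hp⟩, ⟨q, hq⟩⟩ := ih
      refine ⟨⟨3 * p - 4 * q - 2, ?_⟩, ⟨4 * p + 3 * q + 4, ?_⟩⟩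
      · simp only [uv]; linarith
      · simp only [uv]; linarith

/-- `v_M ≠ 0` for `M ≥ 1`. -/
theorem uv_snd_ne_zero {M : ℕ} (hM : 1 ≤ M) : (uv M).2 ≠ 0 := by
  intro h
  obtain ⟨q, hq⟩ := (uv_mod_five M hM).2
  omega

/-- `e^{i(Uπ + Vℓ₀)} = (−1)^U ((3+4i)/5)^V`. -/
theorem cexp_lattice_eq (U V : ℤ) :
    cexp ((((U : ℝ) * Real.pi + (V : ℝ) * ell : ℝ) : ℂ) * I) = (-1) ^ U * ((3 + 4 * I) / 5) ^ V := by
  have e : (((U : ℝ) * Real.pi + (V : ℝ) * ell : ℝ) : ℂ) * I =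
      (U : ℂ) * ((Real.pi : ℂ) * I) + (V : ℂ) * ((ell : ℂ) * I) := by push_cast; ring
  rw [e, Complex.exp_add, Complex.exp_int_mul, Complex.exp_int_mul, Complex.exp_pi_mul_I, cexp_ell]

/-- `(−1)^U = ±1`. -/
private theorem neg_one_zpow_eq (U : ℤ) : ∃ σ : ℤ, (σ = 1 ∨ σ = -1) ∧ ((-1 : ℂ) ^ U) = (σ : ℂ) := by
  rcases Int.even_or_odd U with hU | hU
  · exact ⟨1, Or.inl rfl, by rw [hU.neg_one_zpow]; simp⟩
  · exact ⟨-1, Or.inr rfl, by rw [hU.neg_one_zpow]; simp⟩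

/-- `5^{|V|} · α₀^V` is the Gaussian integer `u ± v i` with `(u, v) = uv |V|`. -/
theorem five_pow_mul_alpha_zpow (V : ℤ) : ∃ ε : ℤ, (ε = 1 ∨ ε = -1) ∧
    (5 : ℂ) ^ V.natAbs * ((3 + 4 * I) / 5) ^ V =
      (((uv V.natAbs).1 : ℤ) : ℂ) + ((ε * (uv V.natAbs).2 : ℤ) : ℂ) * I := by
  rcases le_or_gt 0 V with hV | hV
  · obtain ⟨n, rfl⟩ := Int.eq_ofNat_of_zero_le hV
    refine ⟨1, Or.inl rfl, ?_⟩
    rw [Int.natAbs_natCast, zpow_natCast, div_pow, mul_div_cancel₀ _ (pow_ne_zero _ (by norm_num)),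
      ← uv_spec]
    push_cast; ring
  · obtain ⟨n, hn⟩ := Int.exists_eq_neg_ofNat hV.le
    subst hn
    refine ⟨-1, Or.inr rfl, ?_⟩
    have h34 : (3 + 4 * I : ℂ) ≠ 0 := by
      intro h; have := congrArg Complex.re h; simp at this
    have hinv : ((3 + 4 * I) / 5 : ℂ)⁻¹ = (3 - 4 * I) / 5 := by
      rw [inv_div, div_eq_div_iff h34 (by norm_num)]
      linear_combination (16) * I_sq
    rw [Int.natAbs_neg, Int.natAbs_natCast, zpow_neg, zpow_natCast, ← inv_pow, hinv, div_pow,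
      mul_div_cancel₀ _ (pow_ne_zero _ (by norm_num)), ← uv_conj]
    push_cast; ring

/-- **Elementary lower bound for the linear form in two logarithms** `Uπ + Vℓ₀`, `V ≠ 0`:
`|Uπ + Vℓ₀| ≥ 5^{−|V|}` (in particular `ℓ₀/π ∉ ℚ`). -/
theorem lattice_lower (U : ℤ) {V : ℤ} (hV : V ≠ 0) :
    1 / (5 : ℝ) ^ V.natAbs ≤ |(U : ℝ) * Real.pi + (V : ℝ) * ell| := by
  obtain ⟨ε, hε, hG⟩ := five_pow_mul_alpha_zpow V
  obtain ⟨σ, hσ, hσU⟩ := neg_one_zpow_eq U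
  have hn : 1 ≤ V.natAbs := Int.natAbs_pos.mpr hV
  have hv := uv_snd_ne_zero hn
  set n := V.natAbs with hn_def
  set θ : ℝ := (U : ℝ) * Real.pi + (V : ℝ) * ell with hθ
  have hGe : (5 : ℂ) ^ n * (cexp ((θ : ℂ) * I) - 1) =
      (((σ * (uv n).1 - 5 ^ n : ℤ)) : ℂ) + (((σ * (ε * (uv n).2) : ℤ)) : ℂ) * I := by
    rw [hθ, cexp_lattice_eq, hσU, mul_sub, mul_one, mul_left_comm, hG]; push_cast; ring
  have him : |((5 : ℂ) ^ n * (cexp ((θ : ℂ) * I) - 1)).im| = |(((uv n).2 : ℤ) : ℝ)| := by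
    rw [hGe]
    simp only [Complex.add_im, Complex.intCast_im, Complex.mul_im, Complex.intCast_re, Complex.I_im,
      Complex.I_re, mul_one, mul_zero, zero_add, add_zero]
    push_cast
    rw [abs_mul, abs_mul]
    rcases hσ with rfl | rfl <;> rcases hε with rfl | rfl <;> simp
  have h1 : (1 : ℝ) ≤ |(((uv n).2 : ℤ) : ℝ)| := by exact_mod_cast Int.one_le_abs hv
  have h2 := Complex.abs_im_le_norm ((5 : ℂ) ^ n * (cexp ((θ : ℂ) * I) - 1))
  have h3 : ‖(5 : ℂ) ^ n * (cexp ((θ : ℂ) * I) - 1)‖ ≤ (5 : ℝ) ^ n * |θ| := by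
    rw [norm_mul, norm_pow, show ‖(5 : ℂ)‖ = 5 by simp]
    gcongr
    have := Real.norm_exp_I_mul_ofReal_sub_one_le (x := θ)
    rw [mul_comm, Real.norm_eq_abs] at this
    exact this
  have h5 : (0 : ℝ) < 5 ^ n := by positivity
  rw [div_le_iff₀ h5]
  rw [him] at h2
  nlinarith

/-- `Uπ + Vℓ₀ ≠ 0` for `V ≠ 0`. -/
theorem lattice_ne_zero (U : ℤ) {V : ℤ} (hV : V ≠ 0) : (U : ℝ) * Real.pi + (V : ℝ) * ell ≠ 0 := by
  intro h
  have := lattice_lower U hV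
  rw [h, abs_zero] at this
  exact absurd this (not_le.mpr (by positivity))

/-- The exponent arithmetic: with `m = c₀ + d + 2`, `K = 3m + 3`: `10 · d · 2^{a_K} · 5^{2^{a_K} c₀} < 2^{a_{K+1}}`. -/
theorem arith_K (c₀ d m K : ℕ) (hm : m = c₀ + d + 2) (hK : K = 3 * m + 3) :
    10 * (d * 2 ^ hexp K) * 5 ^ (2 ^ hexp K * c₀) < 2 ^ hexp (K + 1) := by
  have h4 := four_mul_two_pow_le_hexp_succ m K (by omega)
  set h := hexp K with hh
  set N := 2 ^ h * c₀ with hN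
  have A : 10 * (d * 2 ^ h) * 5 ^ N ≤ 10 * (2 ^ d * 2 ^ h) * 2 ^ (3 * N) := by
    have hd : d ≤ 2 ^ d := Nat.lt_two_pow_self.le
    have h5 : 5 ^ N ≤ 2 ^ (3 * N) :=
      calc 5 ^ N ≤ (2 ^ 3) ^ N := Nat.pow_le_pow_left (show 5 ≤ 2 ^ 3 by norm_num) N
        _ = 2 ^ (3 * N) := (pow_mul 2 3 N).symm
    gcongr
  have B : 10 * (2 ^ d * 2 ^ h) * 2 ^ (3 * N) < 2 ^ (4 + d + h + 3 * N) := by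
    have e : 2 ^ (4 + d + h + 3 * N) = 16 * (2 ^ d * 2 ^ h) * 2 ^ (3 * N) := by
      rw [pow_add, pow_add, pow_add]; norm_num; ring
    rw [e]
    have hx : 0 < (2 ^ d * 2 ^ h) * 2 ^ (3 * N) := by positivity
    nlinarith
  have C : 4 + d + h + 3 * N ≤ hexp (K + 1) := by
    refine le_trans ?_ h4
    have F1 : h + 1 ≤ 2 ^ h := Nat.lt_two_pow_self
    have F2 : m + 1 ≤ 4 ^ m := Nat.lt_pow_self (by norm_num)
    have F3 : 2 ^ h * 4 ^ m ≤ 2 ^ (m * (h + 2)) := by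
      rw [show (4 : ℕ) = 2 ^ 2 by norm_num, ← pow_mul, ← pow_add]
      exact Nat.pow_le_pow_right (by norm_num) (by nlinarith)
    have G1 : 2 ^ h * (m + 1) ≤ 2 ^ h * 4 ^ m := Nat.mul_le_mul_left _ F2
    have G2 : d ≤ 2 ^ h * d := Nat.le_mul_of_pos_left _ (by positivity)
    rw [hN]
    nlinarith
  calc 10 * (d * 2 ^ h) * 5 ^ N ≤ 10 * (2 ^ d * 2 ^ h) * 2 ^ (3 * N) := A
    _ < 2 ^ (4 + d + h + 3 * N) := B
    _ ≤ 2 ^ hexp (K + 1) := Nat.pow_le_pow_right (by norm_num) C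

end Bilog
end LatCell
end HyperCell
end Summit.Schanuel.Schanuel.Theorems.RootDecomp1KHyper
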